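import Literature.Probability.RandomPlanarGeometry.HexSAWBrickWallSlabCuts
import Literature.Probability.RandomPlanarGeometry.HexSAWBrickWallStripMargin
import HarnessLib

/-!
# From an abstract row insertion to the margin and to `μ(Slab_H) < μ(Slab_{H+1})`: the summation step of
# «HEX-ARMCHAIR-SLAB-SUBCRIT»

Topic `Literature/Probability/RandomPlanarGeometry` (the coordinate-0 twin of `HexSAWBrickWallStripInsertionCore.lean` and of the
strip part of `HexSAWBrickWallStripMargin.lean`; continues `HexSAWBrickWallSlabCuts.lean` — the parity-admissible row cuts
`HexBW.admissibleSlabCuts H a ω n` of a walk of the column slab `Slab_H`, at least `⌊n/(2(H+1))⌋` of them — and uses the lattice-free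
extraction `SAW.MarginExtraction.log_margin_of_core`).  Source of the statement shape: N. Madras, G. Slade, *The Self-Avoiding Walk*
(1993), §8.2, Theorem 8.2.1 (8.2.13) (strict monotonicity in the width; printed without margin).

## What is proved (lane «pcv-sawmu», door R100 «HEX-ARMCHAIR-SLAB-SUBCRIT», a-p5 g7)

Let an INSERTION for the width `H ≥ 1` be given abstractly: for every `n`, a map `Ψ n` from pairs `(p, R)` — `p = (a, ω) ∈ slabPairs H n`,
`R ⊆ admissibleSlabCuts H a ω n` — to pairs, and a cost `cost n p c ∈ ℕ` per cut, such that (i) `Ψ n p R ∈ slabPairs (H+1) (n + Σ cost)`,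
(ii) `cost n p c ≤ 2H + 4`, (iii) `(p, R) ↦ Ψ n p R` is injective on that domain.  THEN: `slab_core_of_insertion` (the summed finite core
`c_n(Slab_H) xⁿ (1 + x^{2H+4})^{⌊n/(2(H+1))⌋} ≤ Σ_{m ≤ (2H+5)n} c_m(Slab_{H+1}) x^m`), the margin
`log(1 + μ(Slab_{H+1})^{-(2H+4)})/(2(H+1)) ≤ log μ(Slab_{H+1}) − log μ(Slab_H)` (`log_slabConnectiveConstant_succ_sub_log_ge_of_insertion`),
and `μ(Slab_H) < μ(Slab_{H+1})` (`slabConnectiveConstant_lt_succ_of_insertion`); also the core-to-margin lemmas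
`pow_slabConnectiveConstant_le_slabCount`, `log_slabConnectiveConstant_succ_sub_log_ge_of_core`,
`log_hexConnectiveConstant_sub_log_slabConnectiveConstant_ge_of_core`, `slabConnectiveConstant_lt_succ_of_core`.
The double-row insertion itself (a-p5 g7 design `R100-DESIGN.md`, refute-first cell PASS) is NOT constructed here; this file fixes its target.
-/

noncomputable section

open Finset Filter Topology Literature.Probability.LatticeModels Literature.Probability.Percolation

namespace Literature.Probability.RandomPlanarGeometry.SAW

namespace HexBW

open MarginExtraction

/-- `μ(Slab_H)ⁿ ≤ c_n(Slab_H)` for every `n` ("`μ(R) = inf_{N ≥ 1} c_N(R)^{1/N}`", (8.2.3)), honeycomb row strips.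
[cite: MadrasSlade1993, §8.2, eq. (8.2.3)] -/
theorem pow_slabConnectiveConstant_le_slabCount {H : ℕ} (hH : 1 ≤ H) (n : ℕ) :
    slabConnectiveConstant H ^ n ≤ (slabCount H n : ℝ) := by
  rcases Nat.eq_zero_or_pos n with rfl | hn
  · rw [pow_zero]; exact_mod_cast one_le_slabCount hH 0
  have h := slabConnectiveConstant_le_rpow H hn.ne'
  have hc : (0 : ℝ) ≤ slabCount H n := Nat.cast_nonneg _
  calc slabConnectiveConstant H ^ n ≤ ((slabCount H n : ℝ) ^ (1 / (n : ℝ))) ^ n :=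
        pow_le_pow_left₀ (slabConnectiveConstant_pos hH).le h n
    _ = slabCount H n := by rw [one_div, Real.rpow_inv_natCast_pow hc hn.ne']

/-- **Margin from the finite core, strip-to-strip** (face H5 of the door «HEX-STRIP-STRICT»): if an insertion gives
`c_n(Slab_H) xⁿ (1 + x^{2H+4})^{⌊n/(2(H+1))⌋} ≤ B Σ_{m ≤ Kn} c_m(Slab_{H+1}) x^m` for all `n` and `0 < x ≤ 1`, then
`log(1 + μ(Slab_{H+1})^{-(2H+4)}) / (2(H+1)) ≤ log μ(Slab_{H+1}) − log μ(Slab_H)` — the quantitative form of (8.2.13) for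
honeycomb strips (printed without margin: BBdGDCG 2014 Prop. 7 at `y = 1`).
[cite: MadrasSlade1993, §8.2, Theorem 8.2.1, eq. (8.2.13) (quantitative form, conditional on the insertion core)]
[cite: BeatonBousquetMelouDeGierDuminilCopinGuttmann2014, Proposition 7 (y = 1)] -/
theorem log_slabConnectiveConstant_succ_sub_log_ge_of_core {H : ℕ} (hH : 1 ≤ H) {B : ℝ} {K : ℕ} (hB : 0 ≤ B)
    (h : ∀ n : ℕ, ∀ x : ℝ, 0 < x → x ≤ 1 →
      (slabCount H n : ℝ) * x ^ n * (1 + x ^ (2 * H + 4)) ^ (n / (2 * (H + 1))) ≤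
        B * ∑ m ∈ Finset.range (K * n + 1), (slabCount (H + 1) m : ℝ) * x ^ m) :
    Real.log (1 + slabConnectiveConstant (H + 1) ^ (-(2 * (H : ℝ) + 4))) / (2 * ((H : ℝ) + 1)) ≤
      Real.log (slabConnectiveConstant (H + 1)) - Real.log (slabConnectiveConstant H) := by
  have hx := log_margin_of_core (E := 2 * H + 4) (L := 2 * H + 1) (K := K)
    (C := fun m => (slabCount (H + 1) m : ℝ)) (B := B) (slabConnectiveConstant_pos hH)
    (one_le_slabConnectiveConstant (by omega : 1 ≤ H + 1)) hB (fun m => Nat.cast_nonneg _) (tendsto_slabCount_rpow (by omega : 1 ≤ H + 1))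
    fun n x hx0 hx1 => by
      have e : n / (2 * H + 1 + 1) = n / (2 * (H + 1)) := by congr 1
      rw [e]
      exact (mul_le_mul_of_nonneg_right (mul_le_mul_of_nonneg_right
        (pow_slabConnectiveConstant_le_slabCount hH n) (pow_nonneg hx0.le n))
        (pow_nonneg (by linarith [pow_nonneg hx0.le (2 * H + 4)]) _)).trans (h n x hx0 hx1)
  have e1 : ((2 * H + 4 : ℕ) : ℝ) = 2 * (H : ℝ) + 4 := by push_cast; ring
  have e2 : ((2 * H + 1 : ℕ) : ℝ) + 1 = 2 * ((H : ℝ) + 1) := by push_cast; ring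
  rwa [e1, e2] at hx

/-- **Margin from the finite core, strip-to-plane**: the same with `c_m(ℍ)` on the right gives
`log(1 + μ_ℍ^{-(2H+4)}) / (2(H+1)) ≤ log μ_ℍ − log μ(Slab_H)` — the quantitative form of (8.2.11) for honeycomb strips.
[cite: MadrasSlade1993, §8.2, Theorem 8.2.1, eq. (8.2.11) (quantitative form, conditional on the insertion core)] -/
theorem log_hexConnectiveConstant_sub_log_slabConnectiveConstant_ge_of_core {H : ℕ} (hH : 1 ≤ H) {B : ℝ} {K : ℕ} (hB : 0 ≤ B)
    (h : ∀ n : ℕ, ∀ x : ℝ, 0 < x → x ≤ 1 →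
      (slabCount H n : ℝ) * x ^ n * (1 + x ^ (2 * H + 4)) ^ (n / (2 * (H + 1))) ≤
        B * ∑ m ∈ Finset.range (K * n + 1), (hexSawCount m : ℝ) * x ^ m) :
    Real.log (1 + hexConnectiveConstant ^ (-(2 * (H : ℝ) + 4))) / (2 * ((H : ℝ) + 1)) ≤
      Real.log hexConnectiveConstant - Real.log (slabConnectiveConstant H) := by
  have hμ1 : 1 ≤ hexConnectiveConstant := (one_le_slabConnectiveConstant hH).trans (slabConnectiveConstant_le hH)
  have hx := log_margin_of_core (E := 2 * H + 4) (L := 2 * H + 1) (K := K)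
    (C := fun m => (hexSawCount m : ℝ)) (B := B) (slabConnectiveConstant_pos hH) hμ1 hB
    (fun m => Nat.cast_nonneg _) tendsto_hexSawCount_rpow
    fun n x hx0 hx1 => by
      have e : n / (2 * H + 1 + 1) = n / (2 * (H + 1)) := by congr 1
      rw [e]
      exact (mul_le_mul_of_nonneg_right (mul_le_mul_of_nonneg_right
        (pow_slabConnectiveConstant_le_slabCount hH n) (pow_nonneg hx0.le n))
        (pow_nonneg (by linarith [pow_nonneg hx0.le (2 * H + 4)]) _)).trans (h n x hx0 hx1)
  have e1 : ((2 * H + 4 : ℕ) : ℝ) = 2 * (H : ℝ) + 4 := by push_cast; ring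
  have e2 : ((2 * H + 1 : ℕ) : ℝ) + 1 = 2 * ((H : ℝ) + 1) := by push_cast; ring
  rwa [e1, e2] at hx

/-- From the margin to the printed strict inequality `μ(Slab_H) < μ(Slab_{H+1})`, given the core.
[cite: BeatonBousquetMelouDeGierDuminilCopinGuttmann2014, Proposition 7 (y = 1)] [cite: MadrasSlade1993, §8.2, Theorem 8.2.1, eq. (8.2.13)] -/
theorem slabConnectiveConstant_lt_succ_of_core {H : ℕ} (hH : 1 ≤ H) {B : ℝ} {K : ℕ} (hB : 0 ≤ B)
    (h : ∀ n : ℕ, ∀ x : ℝ, 0 < x → x ≤ 1 →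
      (slabCount H n : ℝ) * x ^ n * (1 + x ^ (2 * H + 4)) ^ (n / (2 * (H + 1))) ≤
        B * ∑ m ∈ Finset.range (K * n + 1), (slabCount (H + 1) m : ℝ) * x ^ m) :
    slabConnectiveConstant H < slabConnectiveConstant (H + 1) := by
  have hm := log_slabConnectiveConstant_succ_sub_log_ge_of_core hH hB h
  have hμ := slabConnectiveConstant_pos (by omega : 1 ≤ H + 1)
  have hpos : 0 < Real.log (1 + slabConnectiveConstant (H + 1) ^ (-(2 * (H : ℝ) + 4))) / (2 * ((H : ℝ) + 1)) :=
    div_pos (Real.log_pos (by linarith [Real.rpow_pos_of_pos hμ (-(2 * (H : ℝ) + 4))])) (by positivity)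
  have : Real.log (slabConnectiveConstant H) < Real.log (slabConnectiveConstant (H + 1)) := by linarith
  exact (Real.log_lt_log_iff (slabConnectiveConstant_pos hH) hμ).1 this


section Core

variable {H : ℕ} (Ψ : ℕ → (Site 2 × (ℕ → Site 2)) → Finset ℤ → (Site 2 × (ℕ → Site 2)))
  (cost : ℕ → (Site 2 × (ℕ → Site 2)) → ℤ → ℕ)

/-- The domain of an insertion at length `n`: pairs (walk of `Slab_H`, subset of its admissible cuts).
[cite: MadrasSlade1993, §8.2, Theorem 8.2.1 (8.2.13) (column insertion)] -/
def slabInsDom (H n : ℕ) : Finset (Σ _ : Site 2 × (ℕ → Site 2), Finset ℤ) :=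
  (slabPairs H n).sigma fun p => (admissibleSlabCuts H p.1 p.2 n).powerset

/-- The length of the image of a pair: `n` plus the total cost of the chosen cuts.
[cite: MadrasSlade1993, §8.2, Theorem 8.2.1 (8.2.13)] -/
def slabInsLen (n : ℕ) (q : Σ _ : Site 2 × (ℕ → Site 2), Finset ℤ) : ℕ := n + ∑ c ∈ q.2, cost n q.1 c

/-- Membership in `slabInsDom`. [cite: MadrasSlade1993, §8.2, Theorem 8.2.1 (8.2.13)] -/
theorem mem_slabInsDom {n : ℕ} {q : Σ _ : Site 2 × (ℕ → Site 2), Finset ℤ} :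
    q ∈ slabInsDom H n ↔ q.1 ∈ slabPairs H n ∧ q.2 ⊆ admissibleSlabCuts H q.1.1 q.1.2 n := by
  rw [slabInsDom, Finset.mem_sigma, Finset.mem_powerset]

variable {Ψ cost}

/-- The image length is at most `(2H+5) n` when each cut costs at most `2H+4` (there are at most `n` cuts).
[cite: MadrasSlade1993, §8.2, Theorem 8.2.1 (8.2.13)] -/
theorem slabInsLen_le {n : ℕ}
    (hcost : ∀ p, p ∈ slabPairs H n → ∀ c ∈ admissibleSlabCuts H p.1 p.2 n, cost n p c ≤ 2 * H + 4)
    {q : Σ _ : Site 2 × (ℕ → Site 2), Finset ℤ} (hq : q ∈ slabInsDom H n) :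
    slabInsLen cost n q ≤ (2 * H + 5) * n := by
  obtain ⟨hp, hR⟩ := mem_slabInsDom.1 hq
  have h1 : ∑ c ∈ q.2, cost n q.1 c ≤ ∑ _c ∈ q.2, (2 * H + 4) :=
    Finset.sum_le_sum fun c hc => hcost q.1 hp c (hR hc)
  rw [Finset.sum_const, smul_eq_mul] at h1
  have h2 : q.2.card ≤ n :=
    ((Finset.card_le_card hR).trans (Finset.card_filter_le _ _)).trans (card_slabCuts_le q.1.1 q.1.2 n)
  unfold slabInsLen
  nlinarith

/-- The generating polynomial of the pairs, regrouped by image length. [cite: MadrasSlade1993, §8.2, Theorem 8.2.1 (8.2.13)] -/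
theorem sum_slabInsDom_eq {n : ℕ}
    (hcost : ∀ p, p ∈ slabPairs H n → ∀ c ∈ admissibleSlabCuts H p.1 p.2 n, cost n p c ≤ 2 * H + 4) (x : ℝ) :
    ∑ q ∈ slabInsDom H n, x ^ slabInsLen cost n q =
      ∑ m ∈ Finset.range ((2 * H + 5) * n + 1),
        (((slabInsDom H n).filter fun q => slabInsLen cost n q = m).card : ℝ) * x ^ m := by
  rw [← Finset.sum_fiberwise_of_maps_to (g := slabInsLen cost n) (t := Finset.range ((2 * H + 5) * n + 1))
    fun q hq => Finset.mem_range.2 (Nat.lt_succ_of_le (slabInsLen_le hcost hq))]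
  refine Finset.sum_congr rfl fun m _ => ?_
  rw [Finset.sum_congr rfl fun q hq => by rw [(Finset.mem_filter.1 hq).2], Finset.sum_const, nsmul_eq_mul]

/-- **Upper bound**: the pairs of image length `m` inject into the `m`-step walks of `Slab_{H+1}`.
[cite: MadrasSlade1993, §8.2, Theorem 8.2.1 (8.2.13)] -/
theorem sum_slabInsDom_le {n : ℕ}
    (hcost : ∀ p, p ∈ slabPairs H n → ∀ c ∈ admissibleSlabCuts H p.1 p.2 n, cost n p c ≤ 2 * H + 4)
    (hmem : ∀ p R, p ∈ slabPairs H n → R ⊆ admissibleSlabCuts H p.1 p.2 n →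
      Ψ n p R ∈ slabPairs (H + 1) (n + ∑ c ∈ R, cost n p c))
    (hinj : Set.InjOn (fun q : (Σ _ : Site 2 × (ℕ → Site 2), Finset ℤ) => Ψ n q.1 q.2) ↑(slabInsDom H n))
    {x : ℝ} (hx : 0 ≤ x) :
    ∑ q ∈ slabInsDom H n, x ^ slabInsLen cost n q ≤
      ∑ m ∈ Finset.range ((2 * H + 5) * n + 1), (slabCount (H + 1) m : ℝ) * x ^ m := by
  rw [sum_slabInsDom_eq hcost]
  refine Finset.sum_le_sum fun m _ => mul_le_mul_of_nonneg_right ?_ (pow_nonneg hx m)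
  rw [slabCount]
  exact_mod_cast Finset.card_le_card_of_injOn (fun q : (Σ _ : Site 2 × (ℕ → Site 2), Finset ℤ) => Ψ n q.1 q.2)
    (fun q hq => by
      have hq' := Finset.mem_filter.1 (Finset.mem_coe.1 hq)
      obtain ⟨hp, hR⟩ := mem_slabInsDom.1 hq'.1
      have h := hmem q.1 q.2 hp hR
      have e : n + ∑ c ∈ q.2, cost n q.1 c = m := hq'.2
      rw [e] at h
      exact Finset.mem_coe.2 h)
    (hinj.mono fun q hq => by
      exact Finset.mem_coe.2 (Finset.mem_filter.1 (Finset.mem_coe.1 hq)).1)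

/-- **Lower bound**: `Σ_{R ⊆ adm} x^{len} = xⁿ Π_{c ∈ adm} (1 + x^{cost c}) ≥ xⁿ (1 + x^{2H+4})^{⌊n/(2(H+1))⌋}` for each
walk of `Slab_H` (`x ≤ 1`, `#adm ≥ ⌊n/(2(H+1))⌋`), summed over the walks. [cite: MadrasSlade1993, §8.2, Theorem 8.2.1 (8.2.13)] -/
theorem le_sum_slabInsDom {n : ℕ}
    (hcost : ∀ p, p ∈ slabPairs H n → ∀ c ∈ admissibleSlabCuts H p.1 p.2 n, cost n p c ≤ 2 * H + 4)
    {x : ℝ} (hx : 0 ≤ x) (hx1 : x ≤ 1) :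
    (slabCount H n : ℝ) * x ^ n * (1 + x ^ (2 * H + 4)) ^ (n / (2 * (H + 1))) ≤
      ∑ q ∈ slabInsDom H n, x ^ slabInsLen cost n q := by
  rw [slabInsDom, Finset.sum_sigma]
  have key : ∀ p ∈ slabPairs H n,
      x ^ n * (1 + x ^ (2 * H + 4)) ^ (n / (2 * (H + 1))) ≤
        ∑ R ∈ (admissibleSlabCuts H p.1 p.2 n).powerset, x ^ slabInsLen cost n ⟨p, R⟩ := by
    intro p hp
    have hp' : (p.1, p.2) ∈ slabPairs H n := hp
    show _ ≤ ∑ R ∈ (admissibleSlabCuts H p.1 p.2 n).powerset, x ^ (n + ∑ c ∈ R, cost n p c)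
    rw [Finset.sum_congr rfl fun R _ => by rw [pow_add, ← Finset.prod_pow_eq_pow_sum],
      ← Finset.mul_sum, ← Finset.prod_one_add]
    refine mul_le_mul_of_nonneg_left ?_ (pow_nonneg hx n)
    calc (1 + x ^ (2 * H + 4)) ^ (n / (2 * (H + 1)))
        ≤ (1 + x ^ (2 * H + 4)) ^ (admissibleSlabCuts H p.1 p.2 n).card :=
          pow_le_pow_right₀ (by linarith [pow_nonneg hx (2 * H + 4)]) (div_le_card_admissibleSlabCuts hp')
      _ = ∏ _c ∈ admissibleSlabCuts H p.1 p.2 n, (1 + x ^ (2 * H + 4)) := (Finset.prod_const _).symm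
      _ ≤ ∏ c ∈ admissibleSlabCuts H p.1 p.2 n, (1 + x ^ cost n p c) :=
          Finset.prod_le_prod (fun c _ => by linarith [pow_nonneg hx (2 * H + 4)]) fun c hc => by
            have := pow_le_pow_of_le_one hx hx1 (hcost p hp c hc); linarith
  calc (slabCount H n : ℝ) * x ^ n * (1 + x ^ (2 * H + 4)) ^ (n / (2 * (H + 1)))
      = ∑ _p ∈ slabPairs H n, x ^ n * (1 + x ^ (2 * H + 4)) ^ (n / (2 * (H + 1))) := by
        rw [slabCount, Finset.sum_const, nsmul_eq_mul, mul_assoc]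
    _ ≤ _ := Finset.sum_le_sum key

/-- **The summed finite core from an abstract insertion**: if for every `n` the insertion `Ψ n` maps the pairs
(walk of `Slab_H`, subset of its admissible cuts) injectively to walks of `Slab_{H+1}` of length `n + total cost`, each cut
costing at most `2H+4`, then `c_n(Slab_H) xⁿ (1 + x^{2H+4})^{⌊n/(2(H+1))⌋} ≤ Σ_{m ≤ (2H+5)n} c_m(Slab_{H+1}) x^m` for all `n`
and `0 < x ≤ 1`. [cite: MadrasSlade1993, §8.2, Theorem 8.2.1 (8.2.13) (the lane's column insertion, summed)] -/
theorem slab_core_of_insertion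
    (hcost : ∀ n p, p ∈ slabPairs H n → ∀ c ∈ admissibleSlabCuts H p.1 p.2 n, cost n p c ≤ 2 * H + 4)
    (hmem : ∀ n p R, p ∈ slabPairs H n → R ⊆ admissibleSlabCuts H p.1 p.2 n →
      Ψ n p R ∈ slabPairs (H + 1) (n + ∑ c ∈ R, cost n p c))
    (hinj : ∀ n, Set.InjOn (fun q : (Σ _ : Site 2 × (ℕ → Site 2), Finset ℤ) => Ψ n q.1 q.2) ↑(slabInsDom H n)) :
    ∀ n : ℕ, ∀ x : ℝ, 0 < x → x ≤ 1 →
      (slabCount H n : ℝ) * x ^ n * (1 + x ^ (2 * H + 4)) ^ (n / (2 * (H + 1))) ≤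
        1 * ∑ m ∈ Finset.range ((2 * H + 5) * n + 1), (slabCount (H + 1) m : ℝ) * x ^ m := by
  intro n x hx hx1
  rw [one_mul]
  exact (le_sum_slabInsDom (hcost n) hx.le hx1).trans (sum_slabInsDom_le (hcost n) (hmem n) (hinj n) hx.le)

/-- **HEX-STRIP-STRICT from an insertion, with margin**: under (i)–(iii),
`log(1 + μ(Slab_{H+1})^{-(2H+4)}) / (2(H+1)) ≤ log μ(Slab_{H+1}) − log μ(Slab_H)` (a-idea-1's face `StripStrictMargin H`).
[cite: MadrasSlade1993, §8.2, Theorem 8.2.1, eq. (8.2.13) (quantitative form, conditional on the insertion)]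
[cite: BeatonBousquetMelouDeGierDuminilCopinGuttmann2014, Proposition 7 (y = 1)] -/
theorem log_slabConnectiveConstant_succ_sub_log_ge_of_insertion (hH : 1 ≤ H)
    (hcost : ∀ n p, p ∈ slabPairs H n → ∀ c ∈ admissibleSlabCuts H p.1 p.2 n, cost n p c ≤ 2 * H + 4)
    (hmem : ∀ n p R, p ∈ slabPairs H n → R ⊆ admissibleSlabCuts H p.1 p.2 n →
      Ψ n p R ∈ slabPairs (H + 1) (n + ∑ c ∈ R, cost n p c))
    (hinj : ∀ n, Set.InjOn (fun q : (Σ _ : Site 2 × (ℕ → Site 2), Finset ℤ) => Ψ n q.1 q.2) ↑(slabInsDom H n)) :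
    Real.log (1 + slabConnectiveConstant (H + 1) ^ (-(2 * (H : ℝ) + 4))) / (2 * ((H : ℝ) + 1)) ≤
      Real.log (slabConnectiveConstant (H + 1)) - Real.log (slabConnectiveConstant H) :=
  log_slabConnectiveConstant_succ_sub_log_ge_of_core hH zero_le_one (slab_core_of_insertion hcost hmem hinj)

/-- **HEX-STRIP-STRICT from an insertion**: under (i)–(iii), `μ(Slab_H) < μ(Slab_{H+1})`.
[cite: BeatonBousquetMelouDeGierDuminilCopinGuttmann2014, Proposition 7 (y = 1)] [cite: MadrasSlade1993, §8.2, Theorem 8.2.1, eq. (8.2.13)] -/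
theorem slabConnectiveConstant_lt_succ_of_insertion (hH : 1 ≤ H)
    (hcost : ∀ n p, p ∈ slabPairs H n → ∀ c ∈ admissibleSlabCuts H p.1 p.2 n, cost n p c ≤ 2 * H + 4)
    (hmem : ∀ n p R, p ∈ slabPairs H n → R ⊆ admissibleSlabCuts H p.1 p.2 n →
      Ψ n p R ∈ slabPairs (H + 1) (n + ∑ c ∈ R, cost n p c))
    (hinj : ∀ n, Set.InjOn (fun q : (Σ _ : Site 2 × (ℕ → Site 2), Finset ℤ) => Ψ n q.1 q.2) ↑(slabInsDom H n)) :
    slabConnectiveConstant H < slabConnectiveConstant (H + 1) :=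
  slabConnectiveConstant_lt_succ_of_core hH zero_le_one (slab_core_of_insertion hcost hmem hinj)

end Core


end HexBW

end Literature.Probability.RandomPlanarGeometry.SAW
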